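import Literature.Computability.Complexity.MPGSignVerifier
import Literature.Computability.Complexity.CodeFPStrings
import Literature.Computability.Complexity.LengthCompare
import HarnessLib

/-!
# Mean-payoff games over the additive reals: the certificate verifier is polynomial-time

Topic `Literature/Computability/Complexity`, grouping namespace `MPGSignVerifier` (continuing
`MPGSignVerifier.lean`). The query generator `qgen` of the verifier is in `FP` and its verdict
language `Verdict` is in `P`, so the oracle algorithm `verifier = adAlg qgen X Verdict` has a
polynomial-time step function (`AdQuery.isPolyTime_adAlg`): **`isPolyTime_verifier`**. Everything
is assembled from the typed combinators of the `CodeFP` algebra (`CodeFP.lean`, `CodeFPArith.lean`,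
`CodeFPStrings.lean`: bit access `strGetDNat`, field values `strVal ∘ strTake ∘ strDrop`, `urange`,
`map`, `flatten`, `all`, `rawGetD`, integer arithmetic), one lemma per definition of
`MPGSignVerifier.lean`, each taking typed programs for the arguments (a context `γ` with an
environment accessor) and returning one for the value — no machine and no growth estimate is written
here [AroraBarak2009, §1.3: polynomial time is closed under composition and bounded loops].

## References

* S. Arora, B. Barak, *Computational Complexity: A Modern Approach*, CUP 2009, §1.3. [AroraBarak2009]
* H. Fournier, P. Koiran, *Lower bounds are not easier over the reals: inside PH*, ICALP 2000,
  §3 (`NDP⁰_ℝovs`). [FournierKoiran2000]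
-/

namespace Literature.Computability.Complexity

namespace MPGSignVerifier

open _root_.Computability CodeFP Brick Polynomial

/-- The code of an environment `(n, y)`: `⟨1ⁿ, y⟩` (the verifier's Boolean input). [folklore] -/
abbrev envE : Env → List Bool := pairE unE strE

/-- The code of a check (query, expected bit). [folklore] -/
abbrev chkE : List ℤ × Bool → List Bool := pairE (rawE intE) bitE

section Generic

variable {γ : Type} {eγ : γ → List Bool} {fe : γ → Env} {fa fb fu fv : γ → ℕ}

/-! ### Arithmetic in a context -/

/-- Sum of two computed numerals. [folklore] -/
theorem addC (ha : CodeFP eγ natE fa) (hb : CodeFP eγ natE fb) : CodeFP eγ natE (fun c => fa c + fb c) :=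
  (natAdd.comp (ha.pair hb) :)

/-- Product of two computed numerals. [folklore] -/
theorem mulC (ha : CodeFP eγ natE fa) (hb : CodeFP eγ natE fb) : CodeFP eγ natE (fun c => fa c * fb c) :=
  (natMul.comp (ha.pair hb) :)

/-- Truncated difference of two computed numerals. [folklore] -/
theorem subC (ha : CodeFP eγ natE fa) (hb : CodeFP eγ natE fb) : CodeFP eγ natE (fun c => fa c - fb c) :=
  (natSub.comp (ha.pair hb) :)

/-- Minimum of two computed numerals. [folklore] -/
theorem minC (ha : CodeFP eγ natE fa) (hb : CodeFP eγ natE fb) : CodeFP eγ natE (fun c => min (fa c) (fb c)) :=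
  (natMin.comp (ha.pair hb) :)

/-- Equality test of two computed numerals. [folklore] -/
theorem eqC (ha : CodeFP eγ natE fa) (hb : CodeFP eγ natE fb) : CodeFP eγ bitE (fun c => decide (fa c = fb c)) :=
  (natEq.comp (ha.pair hb) :)

/-- A numeral constant. [folklore] -/
theorem cstC (m : ℕ) : CodeFP eγ natE (fun _ => m) := const eγ m

/-- The arena size is polynomial-time. [folklore] -/
theorem arenaC : CodeFP natE natE arena :=
  (natSqrt.comp (natDiv.comp ((CodeFP.id natE).pair (const natE 2))) :)

/-- `valid` is polynomial-time. [folklore] -/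
theorem validC : CodeFP natE bitE valid :=
  ((natLt.comp ((const natE 0).pair arenaC)).and
    (natEq.comp ((addC arenaC (mulC (mulC (cstC 2) arenaC) arenaC)).pair (CodeFP.id natE))) :)

/-! ### Readers of the environment -/

/-- Dropping at a position capped by the length is dropping. [folklore] -/
private theorem drop_min_length (y : List Bool) (p : ℕ) : y.drop (min p y.length) = y.drop p := by
  rcases le_total p y.length with h | h
  · rw [min_eq_left h]
  · rw [min_eq_right h, List.drop_of_length_le (le_refl _), List.drop_of_length_le h]

variable (he : CodeFP eγ envE fe)
include he

/-- The dimension, in unary. [folklore] -/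
theorem nUnC : CodeFP eγ unE (fun c => (fe c).1) := ((fst unE strE).comp he :)

/-- The witness. [folklore] -/
theorem yC : CodeFP eγ strE (fun c => (fe c).2) := ((snd unE strE).comp he :)

/-- The dimension, in binary. [folklore] -/
theorem nC : CodeFP eγ natE (fun c => (fe c).1) := (natOfUn.comp (nUnC he) :)

/-- The arena size, in binary. [folklore] -/
theorem kC : CodeFP eγ natE (fun c => kOf (fe c)) := (arenaC.comp (nC he) :)

/-- The arena size, in unary (capped by the dimension, which it never exceeds). [folklore] -/
theorem kUnC : CodeFP eγ unE (fun c => kOf (fe c)) :=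
  (unOfNatMin.comp ((nUnC he).pair (kC he))).congr fun _ => min_eq_left (arena_le _)

/-- Bit access. [folklore] -/
theorem rdC (ha : CodeFP eγ natE fa) : CodeFP eγ bitE (fun c => rd (fe c) (fa c)) :=
  (strGetDNat.comp ((yC he).pair ha) :)

/-- Field access (the position is capped by `|y|` to be converted to unary; dropping at the capped
position is dropping). [folklore] -/
theorem fldC (ha : CodeFP eγ natE fa) : CodeFP eγ natE (fun c => fld (fe c) (fa c)) :=
  (strVal.comp (strTake.comp ((kUnC he).pair (strDrop.comp
    ((unOfNatMin.comp (((strLength.comp (yC he)).pair ha))).pair (yC he)))))).congr fun c => by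
      unfold fld
      exact congrArg bitsToNat (congrArg (List.take (kOf (fe c))) (drop_min_length _ _))

/-- `inR`. [folklore] -/
theorem inRC (hu : CodeFP eγ natE fu) : CodeFP eγ bitE (fun c => inR (fe c) (fu c)) := rdC he hu

/-- `isMax`. [folklore] -/
theorem isMaxC (hu : CodeFP eγ natE fu) : CodeFP eγ bitE (fun c => isMax (fe c) (fu c)) :=
  rdC he (addC (kC he) hu)

/-- `side`. [folklore] -/
theorem sideC (hu : CodeFP eγ natE fu) : CodeFP eγ bitE (fun c => side (fe c) (fu c)) :=
  rdC he (addC (mulC (cstC 2) (kC he)) hu)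

/-- `noEdge`. [folklore] -/
theorem noEdgeC (hu : CodeFP eγ natE fu) (hv : CodeFP eγ natE fv) :
    CodeFP eγ bitE (fun c => noEdge (fe c) (fu c) (fv c)) :=
  rdC he (addC (mulC (cstC 3) (kC he)) (addC (mulC hu (kC he)) hv))

/-- `noEdgeSide`. [folklore] -/
theorem noEdgeSideC (hu : CodeFP eγ natE fu) (hv : CodeFP eγ natE fv) :
    CodeFP eγ bitE (fun c => noEdgeSide (fe c) (fu c) (fv c)) :=
  rdC he (addC (addC (mulC (cstC 3) (kC he)) (mulC (kC he) (kC he))) (addC (mulC hu (kC he)) hv))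

/-- `num`. [folklore] -/
theorem numC (ha : CodeFP eγ natE fa) : CodeFP eγ natE (fun c => num (fe c) (fa c)) :=
  fldC he (addC (addC (mulC (cstC 3) (kC he)) (mulC (mulC (cstC 2) (kC he)) (kC he))) (mulC ha (kC he)))

/-- `tot`. [folklore] -/
theorem totC (hu : CodeFP eγ natE fu) : CodeFP eγ natE (fun c => tot (fe c) (fu c)) :=
  minC (subC (kC he) (cstC 1)) (numC he hu)

/-- `succ`. [folklore] -/
theorem succC (hu : CodeFP eγ natE fu) : CodeFP eγ natE (fun c => succ (fe c) (fu c)) :=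
  minC (subC (kC he) (cstC 1)) (numC he (addC (kC he) hu))

/-- `coef`. [folklore] -/
theorem coefC (hv : CodeFP eγ natE fv) (ha : CodeFP eγ natE fa) :
    CodeFP eγ natE (fun c => coef (fe c) (fv c) (fa c)) :=
  numC he (addC (mulC (cstC 2) (kC he)) (addC (mulC hv (nC he)) ha))

/-- `edgeIdx`. [folklore] -/
theorem edgeIdxC (hu : CodeFP eγ natE fu) (hv : CodeFP eγ natE fv) :
    CodeFP eγ natE (fun c => edgeIdx (kOf (fe c)) (fu c) (fv c)) :=
  addC (kC he) (addC (mulC hu (kC he)) hv)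

/-- `wIdx`. [folklore] -/
theorem wIdxC (hu : CodeFP eγ natE fu) (hv : CodeFP eγ natE fv) :
    CodeFP eγ natE (fun c => wIdx (kOf (fe c)) (fu c) (fv c)) :=
  addC (addC (kC he) (mulC (kC he) (kC he))) (addC (mulC hu (kC he)) hv)

/-! ### Queries -/

/-- `unitQ` (the unit vector is a `map` over `range n` with the context). [folklore] -/
theorem unitQC (ha : CodeFP eγ natE fa) (c s : ℤ) : CodeFP eγ (rawE intE) (fun x => unitQ (fe x).1 (fa x) c s) := by
  have hg : CodeFP (pairE eγ natE) intE (fun p => if decide (p.2 = fa p.1) then s else 0) :=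
    ite (eqC (snd eγ natE) (ha.comp (fst eγ natE))) (const _ s) (const _ 0)
  have hm := (map hg).comp ((CodeFP.id eγ).pair (urange.comp (nUnC he)))
  refine ((rawCons intE).comp ((const eγ c).pair hm)).congr fun x => ?_
  simp only [unitQ, id, decide_eq_true_eq]

/-- `geOne`. [folklore] -/
theorem geOneC (ha : CodeFP eγ natE fa) : CodeFP eγ (rawE intE) (fun x => geOne (fe x).1 (fa x)) :=
  unitQC he ha (-1) 1

/-- `leOne`. [folklore] -/
theorem leOneC (ha : CodeFP eγ natE fa) : CodeFP eγ (rawE intE) (fun x => leOne (fe x).1 (fa x)) :=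
  unitQC he ha 1 (-1)

/-- `potQ`. [folklore] -/
theorem potQC (hu : CodeFP eγ natE fu) (hv : CodeFP eγ natE fv) :
    CodeFP eγ (rawE intE) (fun x => potQ (fe x) (fu x) (fv x)) := by
  have he' : CodeFP (pairE eγ natE) envE (fun p => fe p.1) := he.comp (fst eγ natE)
  have hu' : CodeFP (pairE eγ natE) natE (fun p => fu p.1) := hu.comp (fst eγ natE)
  have hv' : CodeFP (pairE eγ natE) natE (fun p => fv p.1) := hv.comp (fst eγ natE)
  have hi : CodeFP (pairE eγ natE) natE (fun p => p.2) := snd eγ natE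
  have hdiff : CodeFP (pairE eγ natE) intE
      (fun p => ((coef (fe p.1) (fu p.1) p.2 : ℤ) - (coef (fe p.1) (fv p.1) p.2 : ℤ))) :=
    (intSub.comp ((intOfNat.comp (coefC he' hu' hi)).pair (intOfNat.comp (coefC he' hv' hi))) :)
  have hone : CodeFP (pairE eγ natE) intE (fun p => if decide (p.2 = wIdx (kOf (fe p.1)) (fu p.1) (fv p.1)) then (1 : ℤ) else 0) :=
    ite (eqC hi (wIdxC he' hu' hv')) (const _ (1 : ℤ)) (const _ (0 : ℤ))
  have hg : CodeFP (pairE eγ natE) intE (fun p => ((coef (fe p.1) (fu p.1) p.2 : ℤ) - (coef (fe p.1) (fv p.1) p.2 : ℤ)) +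
      (if decide (p.2 = wIdx (kOf (fe p.1)) (fu p.1) (fv p.1)) then (1 : ℤ) else 0)) :=
    (intAdd.comp (hdiff.pair hone) :)
  have hm := (map hg).comp ((CodeFP.id eγ).pair (urange.comp (nUnC he)))
  exact ((rawCons intE).comp ((const eγ (0 : ℤ)).pair hm)).congr fun x => by
    simp only [potQ, id, decide_eq_true_eq]

/-! ### Slots -/

omit he in
/-- A check with a computed query and a constant expected bit. [folklore] -/
theorem chkC {fq : γ → List ℤ} (hq : CodeFP eγ (rawE intE) fq) (b : Bool) :
    CodeFP eγ chkE (fun c => (fq c, b)) := hq.pair (const eγ b)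

omit he in
/-- The trivial slot. [folklore] -/
theorem trivC : CodeFP eγ chkE (fun _ => triv) := const eγ triv

/-- `slot1`. [folklore] -/
theorem slot1C (hu : CodeFP eγ natE fu) : CodeFP eγ chkE (fun c => slot1 (fe c) (fu c)) :=
  (ite (isMaxC he hu) (chkC (geOneC he hu) true)
    (ite (sideC he hu) (chkC (geOneC he hu) false) (chkC (leOneC he hu) false)) :)

/-- `slot2`. [folklore] -/
theorem slot2C (hu : CodeFP eγ natE fu) : CodeFP eγ chkE (fun c => slot2 (fe c) (fu c)) :=
  (ite (isMaxC he hu) (chkC (leOneC he hu) true) trivC :)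

/-- `slot3`. [folklore] -/
theorem slot3C (hu : CodeFP eγ natE fu) : CodeFP eγ chkE (fun c => slot3 (fe c) (fu c)) :=
  chkC (geOneC he (edgeIdxC he hu (totC he hu))) true

/-- `slot4`. [folklore] -/
theorem slot4C (hu : CodeFP eγ natE fu) : CodeFP eγ chkE (fun c => slot4 (fe c) (fu c)) :=
  chkC (leOneC he (edgeIdxC he hu (totC he hu))) true

/-- `slot5`. [folklore] -/
theorem slot5C (hu : CodeFP eγ natE fu) (hv : CodeFP eγ natE fv) :
    CodeFP eγ chkE (fun c => slot5 (fe c) (fu c) (fv c)) :=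
  (ite (inRC he hu)
    (ite (isMaxC he hu)
      (ite (eqC hv (succC he hu)) (chkC (geOneC he (edgeIdxC he hu hv)) true) trivC)
      (ite (noEdgeC he hu hv)
        (ite (noEdgeSideC he hu hv) (chkC (geOneC he (edgeIdxC he hu hv)) false)
          (chkC (leOneC he (edgeIdxC he hu hv)) false))
        trivC))
    trivC).congr fun c => by simp only [slot5, decide_eq_true_eq]

/-- `slot6`. [folklore] -/
theorem slot6C (hu : CodeFP eγ natE fu) (hv : CodeFP eγ natE fv) :
    CodeFP eγ chkE (fun c => slot6 (fe c) (fu c) (fv c)) :=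
  (ite (inRC he hu)
    (ite (isMaxC he hu)
      (ite (eqC hv (succC he hu)) (chkC (leOneC he (edgeIdxC he hu hv)) true) trivC)
      (ite (noEdgeC he hu hv) trivC (chkC (potQC he hu hv) true)))
    trivC).congr fun c => by simp only [slot6, decide_eq_true_eq]

/-- `slot7`. [folklore] -/
theorem slot7C (hu : CodeFP eγ natE fu) (hv : CodeFP eγ natE fv) :
    CodeFP eγ chkE (fun c => slot7 (fe c) (fu c) (fv c)) :=
  (ite (((inRC he hu).and (isMaxC he hu)).and (eqC hv (succC he hu))) (chkC (potQC he hu hv) true) trivC :)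

/-- `vertexSlots`. [folklore] -/
theorem vertexSlotsC (hu : CodeFP eγ natE fu) : CodeFP eγ (rawE chkE) (fun c => vertexSlots (fe c) (fu c)) :=
  ((rawCons chkE).comp ((slot1C he hu).pair ((rawCons chkE).comp ((slot2C he hu).pair
    ((rawCons chkE).comp ((slot3C he hu).pair ((rawSingleton chkE).comp (slot4C he hu))))))) :)

/-- `pairSlots`. [folklore] -/
theorem pairSlotsC (hu : CodeFP eγ natE fu) (hv : CodeFP eγ natE fv) :
    CodeFP eγ (rawE chkE) (fun c => pairSlots (fe c) (fu c) (fv c)) :=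
  ((rawCons chkE).comp ((slot5C he hu hv).pair ((rawCons chkE).comp ((slot6C he hu hv).pair
    ((rawSingleton chkE).comp (slot7C he hu hv))))) :)

/-- `rowSlots` (a `map` over `range k` with the context, flattened). [folklore] -/
theorem rowSlotsC (hu : CodeFP eγ natE fu) : CodeFP eγ (rawE chkE) (fun c => rowSlots (fe c) (fu c)) := by
  have hg : CodeFP (pairE eγ natE) (rawE chkE) (fun p => pairSlots (fe p.1) (fu p.1) p.2) :=
    pairSlotsC (he.comp (fst eγ natE)) (hu.comp (fst eγ natE)) (snd eγ natE)
  have hm := (map hg).comp ((CodeFP.id eγ).pair (urange.comp (kUnC he)))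
  exact ((flatten chkE).comp hm).congr fun c => by simp only [rowSlots, id]

/-- **`checks` is polynomial-time.** [cite: AroraBarak2009, §1.3] -/
theorem checksC : CodeFP eγ (rawE chkE) (fun c => checks (fe c)) := by
  have hg₁ : CodeFP (pairE eγ natE) (rawE chkE) (fun p => vertexSlots (fe p.1) p.2) :=
    vertexSlotsC (he.comp (fst eγ natE)) (snd eγ natE)
  have hg₂ : CodeFP (pairE eγ natE) (rawE chkE) (fun p => rowSlots (fe p.1) p.2) :=
    rowSlotsC (he.comp (fst eγ natE)) (snd eγ natE)
  have hr : CodeFP eγ (pairE eγ (rawE natE)) (fun c => (c, List.range (kOf (fe c)))) :=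
    (CodeFP.id eγ).pair (urange.comp (kUnC he))
  have h₁ := (flatten chkE).comp ((map hg₁).comp hr)
  have h₂ := (flatten chkE).comp ((map hg₂).comp hr)
  exact ((rawAppend chkE).comp (h₁.pair h₂)).congr fun c => by simp only [checks]

/-- `queryAt`. [folklore] -/
theorem queryAtC (ha : CodeFP eγ natE fa) : CodeFP eγ (rawE intE) (fun c => queryAt (fe c) (fa c)) :=
  ((rawGetD (rawE intE) (d := ([] : List ℤ)) rfl).comp (((map₀ (fst (rawE intE) bitE)).comp (checksC he)).pair ha) :)

/-- `expected`. [folklore] -/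
theorem expectedC : CodeFP eγ (rawE bitE) (fun c => expected (fe c)) :=
  ((map₀ (snd (rawE intE) bitE)).comp (checksC he) :)

/-- `sideOK`. [folklore] -/
theorem sideOKC : CodeFP eγ bitE (fun c => sideOK (fe c)) := by
  -- inner `all` over `u'` with context `(c, u)`
  have he₂ : CodeFP (pairE (pairE eγ natE) natE) envE (fun q => fe q.1.1) := he.comp ((fst eγ natE).comp (fst _ natE))
  have hu₂ : CodeFP (pairE (pairE eγ natE) natE) natE (fun q => q.1.2) := (snd eγ natE).comp (fst _ natE)
  have hv₂ : CodeFP (pairE (pairE eγ natE) natE) natE (fun q => q.2) := snd _ natE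
  have hin : CodeFP (pairE (pairE eγ natE) natE) bitE (fun q => noEdge (fe q.1.1) q.1.2 q.2 || inR (fe q.1.1) q.2) :=
    (noEdgeC he₂ hu₂ hv₂).or (inRC he₂ hv₂)
  -- outer `all` over `u` with context `c`
  have he₁ : CodeFP (pairE eγ natE) envE (fun p => fe p.1) := he.comp (fst eγ natE)
  have hu₁ : CodeFP (pairE eγ natE) natE (fun p => p.2) := snd eγ natE
  have hall₂ : CodeFP (pairE eγ natE) bitE
      (fun p => (List.range (kOf (fe p.1))).all fun u' => noEdge (fe p.1) p.2 u' || inR (fe p.1) u') :=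
    ((all hin).comp ((CodeFP.id _).pair (urange.comp (kUnC he₁))) :)
  have hbody : CodeFP (pairE eγ natE) bitE (fun p => !inR (fe p.1) p.2 ||
      (if isMax (fe p.1) p.2 then inR (fe p.1) (succ (fe p.1) p.2)
        else (List.range (kOf (fe p.1))).all fun u' => noEdge (fe p.1) p.2 u' || inR (fe p.1) u')) :=
    ((inRC he₁ hu₁).not.or (ite (isMaxC he₁ hu₁) (inRC he₁ (succC he₁ hu₁)) hall₂) :)
  have hall₁ := (all hbody).comp ((CodeFP.id eγ).pair (urange.comp (kUnC he)))
  exact ((inRC he (cstC 0)).and hall₁).congr fun c => by simp only [sideOK, id]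

/-- `accepts`. [folklore] -/
theorem acceptsC {fb : γ → List Bool} (hb : CodeFP eγ strE fb) :
    CodeFP eγ bitE (fun c => accepts (fe c) (fb c)) := by
  have hexp : CodeFP eγ strE (fun c => expected (fe c)) := (bitsToStr.comp (expectedC he) :)
  have htake : CodeFP eγ strE (fun c => (fb c).take (expected (fe c)).length) :=
    (strTake.comp ((strLength.comp hexp).pair hb) :)
  have heq : CodeFP eγ bitE (fun c => decide ((fb c).take (expected (fe c)).length = expected (fe c))) :=
    ((CodeFP.eq (eα := strE) fun _ _ h => h).comp (htake.pair hexp) :)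
  exact (((validC.comp (nC he)).and (sideOKC he)).and heq :)

end Generic

/-! ### The machine is polynomial-time -/

/-- Parsing a transcript `⟨⟨1ⁿ, y⟩, bits⟩` into its environment and answer bits is polynomial-time
(total on all strings). [folklore] -/
theorem parseC : CodeFP strE (pairE envE strE) (fun w => (envOf w, bitsOf w)) :=
  have hF : CodeFP strE strE fstF := ⟨fstF, fstF_mem_FP, fun _ => rfl⟩
  have hS : CodeFP strE strE sndF := ⟨sndF, sndF_mem_FP, fun _ => rfl⟩
  ((((strLength.comp (hF.comp hF)).pair (hS.comp hF)).pair hS) :)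

/-- A string map computed on strings themselves is in `FP`. [folklore] -/
private theorem mem_FP_of_codeFP_strE {g : List Bool → List Bool} (h : CodeFP strE strE g) : g ∈ FP := by
  obtain ⟨f, hf, hfg⟩ := h
  have hfg' : f = g := funext hfg
  exact hfg' ▸ hf

/-- A language cut out by a typed polynomial-time bit is in `P`. [cite: AroraBarak2009, Def. 1.13] -/
private theorem setOf_codeFP_mem_P {p : List Bool → Bool} (h : CodeFP strE bitE p) :
    ({z | p z = true} : Language Bool) ∈ Classes.P := by
  obtain ⟨F, hF, hFs⟩ := h
  refine mem_P_of_mem_FP hF _ fun z => ⟨fun hz => ?_, fun hz => ?_⟩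
  · rw [show F z = bitE (p z) from hFs z, show p z = true from hz]; rfl
  · rw [show F z = bitE (p z) from hFs z, Bool.eq_false_iff.2 hz]; rfl

/-- **The query generator is in `FP`.** [cite: AroraBarak2009, §1.3] -/
theorem qgen_mem_FP : qgen ∈ FP := by
  have hq : CodeFP strE (rawE intE) (fun w => queryAt (envOf w) (bitsOf w).length) :=
    queryAtC (fe := fun w => envOf w) (fst envE strE |>.comp parseC) (strNatLength.comp ((snd envE strE).comp parseC))
  have h : CodeFP strE (listE smE) (fun w => queryAt (envOf w) (bitsOf w).length) :=
    ((listOfRaw smE).comp ((map₀ smOfInt).comp hq)).congr fun w => by simp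
  refine mem_FP_of_codeFP_strE (h.recodeOut fun w => ?_)
  rw [qgen, listE_eq]
  rfl

/-- **The verdict language is in `P`.** [cite: AroraBarak2009, Def. 1.13] -/
theorem Verdict_mem_P : Verdict ∈ Classes.P :=
  setOf_codeFP_mem_P (acceptsC (fe := fun w => envOf w) ((fst envE strE).comp parseC) ((snd envE strE).comp parseC))

/-- **The verifier is polynomial-time.** [cite: FournierKoiran2000, §3 (NDP⁰_ℝovs)] -/
theorem isPolyTime_verifier : verifier.IsPolyTime encodingBoolBool :=
  AdQuery.isPolyTime_adAlg qgen_mem_FP Verdict_mem_P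

end MPGSignVerifier

end Literature.Computability.Complexity
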